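import Literature.NumberTheory.EllipticCurves.Hsieh2014.AnticyclotomicMuInvariant
import Literature.NumberTheory.EllipticCurves.Hsieh2014.AnticyclotomicPAdicLFunctionAnyLevel
import Literature.NumberTheory.EllipticCurves.UnrIntegersUnits
import HarnessLib

/-!
# Hsieh 2014, Theorem B (= Thm. 2 of the e-print = Thm. 6.2 in the body) AT EVERY LEVEL: the vanishing of
# the anticyclotomic `μ`-invariant of `𝒫_Σ(π_f, λ)` for a weight-2 newform `f = f_E` of level `N` with
# `p^a ∣ N` ARBITRARY (`a = v_p(N) ≥ 2`, i.e. `π_{f,p}` supercuspidal or a ramified twist, INCLUDED), with the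
# `p`-adic CM period in `𝒲^× = R₀^×` — ONE named fact extending `Hsieh2014.thmB_exists_isHsiehLFunction_coeff_norm_eq_one`
# (binder `¬ p ^ 2 ∣ N`) exactly as `Hsieh2014.thmA_exists_isHsiehLFunction_unrPeriod_anyLevel` extends Thm. A

Topic `NumberTheory/EllipticCurves`, sub-directory `Hsieh2014` (namespace = path). Companion of
`Hsieh2014/AnticyclotomicMuInvariant.lean` (Thm. B, binder `¬ p ^ 2 ∣ N`) and of
`Hsieh2014/AnticyclotomicPAdicLFunctionAnyLevel.lean` (Thm. A at every level), whose frame `IsHsiehLFunction`,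
display, receptacle `PowerSeries (PadicComplexInt p) = 𝒪_{ℂ_p}⟦T⟧`, binders, dictionary ((S1)–(S8), (W1)–(W4),
(E1)–(E2), (E1″)) and erratum E-G131-1 are used VERBATIM and not restated. Cell `pub/bsd-wall` (W-ALL row 12,
K12i), lead-prover seat `bsd-wall-bed-p1` (crux (E) `EisensteinDivisibilityCMInertBad[Adm][AtOne]` of route
`BiquadraticEisensteinDescent`, stub `stub_E2` = "`μ(L) = 0` for every BDP frame `L` at an ADDITIVE prime
`p ≥ 5` split in the Heegner field `K′`": `v_p(N) = 2` for every pair of the corner, so the tree's Thm. B fact is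
silent there because of its binder `¬ p ^ 2 ∣ N`; director-bsd 2026-08-27T07:42:56Z (4): "continue on stub_E2
(Hsieh Thm B by-name item)"). HONEST FRAMING: ONE named fact (`def … : Prop`, nothing asserted, no `_holds`;
net debt +1) that IMPLIES the existing Thm. B fact (theorem `thmB_exists_isHsiehLFunction_coeff_norm_eq_one_of_anyLevel`
below: re-insert the dropped binder, read the `R₀`-unit period in norm one) — nothing about stub_E2, the crux, the
route or any case of BSD is proved or claimed. In particular NOTHING is asserted about (a) the `R₀`-rationality of
`Q` (Hsieh's receptacle is `Z̄_p⟦Γ⁻⟧ ⊆ 𝒪_{ℂ_p}⟦T⟧`), (b) the comparison of an `IsHsiehLFunction` frame with a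
Castella-normalised `IsBDPLFunction` frame (different constants; rigidity across periods), (c) hypothesis (2)
(absolute irreducibility of `ρ̄_{E,p}|_{G_K′}`) for any particular curve — the three remaining inputs of stub_E2.

## Source and what is new here (e-print locators `[p. … l. …]` = held text `paper:arxiv-1112.1580`; print =
## Doc. Math. 19 (2014) 709–767, Thm. B p. 712 = Thm. 6.2)

Printed statement [p. 4 ll. 31–37]: "Theorem 2. With the assumptions in Theorem 1, suppose further that (1) `p`
is unramified in `𝓕`, (2) the residual Galois representation `ρ̄_p(π_𝒦) := ρ_p(π)|_{G_𝒦} (mod 𝔪_p)` is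
absolutely irreducible, (3) `p ∤ ∏_{v∣𝔠_λ⁻} #(Δ_{λ,v})`. Then `μ⁻_{π,λ,Σ} = 0`." The assumptions of Theorem 1
are (ord) [p. 3 ll. 26–28], Hypothesis 1 [p. 3 l. 22] and (sf) [p. 4 l. 13] — conditions on the CM type and on
the primes of `𝔫⁻` only; the LEVEL DATUM is "`𝔑` the prime-to-`p` conductor of `π_𝓚 ⊗ λ`" [p. 4 l. 1] and the
construction (§3.6.2 [p. 11 l. 25]: "If the local `L`-function `L(s, π ⊗ χ_w) = 1`, we simply put
`𝒦_{χ,v}(a) = 𝟙_{𝒪^×}(a)χ_w(a⁻¹)`"; Prop. 3.5 [p. 12]) is valid for EVERY local component `π_p` — this is the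
reading (E1″) of the Thm. A any-level file, which typed Thm. A without `¬ p ^ 2 ∣ N`. The proof of Thm. 2 is
Thm. 6.1 [p. 25 l. 23] ("Suppose that `p` is unramified in `𝓕`. Then `μ⁻_{π,λ,Σ} = inf … v_p(𝐚_β(𝐟*_{λ,u}, 𝔠(a)))`")
and Thm. 6.2 [p. 25 l. 54] ("In addition to Hyp. A and (sf), we suppose that `p` is unramified in `𝓕` and the
residual Galois representation `ρ̄_p(π_𝒦)` is absolutely irreducible. Then `μ⁻_{π,λ,Σ} = 0` if and only if
`Σ_{v∣𝔠_λ⁻} μ_p(χ_v) = 0`"), with Remark 6.4 [p. 26 l. 61] ("The assumption (3) in Theorem B implies the vanishing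
of `μ_p(χ_v)` for all `v ∣ 𝔠_λ⁻`"): NO hypothesis on `π_p` or on `v_p(𝔫)` enters §6 either (the toric forms
`𝐟*_{λ,u}` are the `p`-adic avatars of §3–5, defined for every `π`). Hence the companion's binder `¬ p ^ 2 ∣ N`
((S5)) — present there for the ONE reason stated in the Thm. A companion: its evaluation (E1) of the Coates
multiplier `E_{Σ_p}(π_f, χ)` was carried out only for `π_p` unramified or Steinberg — is dropped here exactly as in
the Thm. A any-level fact, by the same reading (E1″) (`L(½, π_p ⊗ χ_𝔭) = 1`, `a_p(f) = 0` by Atkin–Lehner when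
`p² ∣ N`, `ε(½, π_p, ψ_p) = ±1` into `C`, the avatar value removed by `[g_𝔭]^{−a}`, the real monomial `p^{na}`
absorbed by the ∃-quantified `A`). The period is typed in its printed home `Ω_p ∈ 𝒲^× = R₀^×` [p. 23 l. 64]
(Castella–Hsieh 2018 §2.5), as in `thmA_exists_isHsiehLFunction_unrPeriod_anyLevel`; the norm-one form with the
binder re-inserted IS the companion's Thm. B fact (`thmB_exists_isHsiehLFunction_coeff_norm_eq_one_of_anyLevel`).

WEAKER than print on its range (special case `𝓕 = ℚ`, `κ = 2`, `π = π_{f_E}`, unramified critical characters,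
consequence-shaped conclusion "some coefficient of `Q` is a `p`-adic unit"), never stronger.
-- TODO(general form): Hsieh's Thm. B for a general cuspidal `π` of parallel weight `κ` over a totally real `𝓕`,
-- CM type `Σ`, `λ` with `𝔠_λ⁻ ≠ (1)` under hypothesis (3), and the converse Thm. 6.2.

## References

* [Hsieh2014] M.-L. Hsieh, *Special values of anticyclotomic Rankin–Selberg L-functions*, Doc. Math. 19 (2014)
  709–767: Thm. B (p. 712) = arXiv:1112.1580 Thm. 2 [p. 4 ll. 31–38], p. 4 l. 1 (prime-to-`p` conductor),
  §3.6.2 [p. 11 l. 25], Prop. 3.5 [p. 12], Thm. 6.1–6.2 and Remark 6.4 [pp. 25–26], the periods [p. 23 l. 64]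
  — read 2026-08-27 from the store text `paper:arxiv-1112.1580`.
* [CastellaHsieh2018] F. Castella, M.-L. Hsieh, Math. Ann. 370 (2018) §2.5 (the periods `(Ω_K, Ω_p) ∈ ℂ^× × 𝒲^×`).
* Tree: `Hsieh2014/AnticyclotomicMuInvariant.lean` (Thm. B with `¬ p ^ 2 ∣ N`), `Hsieh2014/AnticyclotomicPAdicLFunctionAnyLevel.lean`
  (Thm. A at every level, reading (E1″)), `AnticyclotomicRankinSelbergPAdicLFunction.lean` (`IsHsiehLFunction`),
  `UnrIntegersUnits.lean` (`unrIntegers.isUnit_iff_norm_eq_one`).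
-/

set_option autoImplicit false

noncomputable section

open scoped MatrixGroups ModularForm Topology NumberField
open CongruenceSubgroup NumberField IsDedekindDomain Field
open Literature.NumberTheory.GaloisRepresentations
open Literature.NumberTheory.EllipticCurves.ModularForms
open Literature.NumberTheory.Automorphic

namespace Literature.NumberTheory.EllipticCurves.Hsieh2014

/-- **Hsieh, Doc. Math. 19 (2014), Theorem B (p. 712) = Thm. 2 [arXiv:1112.1580 p. 4 ll. 31–38] = Thm. 6.2,
WITH THE `p`-ADIC CM PERIOD IN `𝒲^× = R₀^×` AND WITHOUT ANY CONDITION ON `v_p(N)`** — the named fact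
`thmB_exists_isHsiehLFunction_coeff_norm_eq_one` of the companion VERBATIM (same binders in the same order, same
conclusion: a frame `(A, Ω_K, C, Ω_p, Q)` with `IsHsiehLFunction ι 𝔭 κ γ f A Ω_K C Ω_p Q` AND a coefficient of `Q`
of norm one, i.e. `Q ≢ 0 (mod 𝔪_{ℂ_p})`, the consequence of `μ⁻_{π_f,λ,Σ} = 0`), EXCEPT that (i) the binder
`¬ p ^ 2 ∣ N` is DROPPED — `π_{f,p}` may have conductor `p^a`, `a ≥ 2` — by the reading (E1″) of the Thm. A
any-level file (Hsieh's level datum is the PRIME-TO-`p` conductor [p. 4 l. 1]; §3.6.2 / Prop. 3.5 and §6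
(Thm. 6.1–6.2, Remark 6.4 [pp. 25–26]) carry no hypothesis on `π_p`), and (ii) `Ω_p : (unrIntegers p)ˣ` (its
printed home `𝒲^×` [p. 23 l. 64]) instead of `Ω_p : ℂ_p, ‖Ω_p‖ = 1`. Hypotheses (1) and (3) of Thm. 2 are
vacuous here (`𝓕 = ℚ`; `𝔠_λ⁻ = (1)` [p. 4 l. 39]); hypothesis (2) is the binder "every framed mod-`p`
representation of `E/K` is absolutely irreducible". WEAKER than print on its range, never stronger; implies the
companion's Thm. B fact (`thmB_exists_isHsiehLFunction_coeff_norm_eq_one_of_anyLevel`). Named fact; nothing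
asserted; no `_holds`.
[cite: Hsieh2014, Thm. B p. 712 (Doc. Math. 19) = Thm. 2 (arXiv:1112.1580 p. 4 ll. 31–38), p. 4 l. 1, §3.6.2 (p. 11 l. 25), Thm. 6.1–6.2 and Remark 6.4 (pp. 25–26), p. 23 l. 64]
[cite: CastellaHsieh2018, §2.5 (arXiv:1505.08165 p. 7)] -/
def thmB_exists_isHsiehLFunction_coeff_norm_eq_one_unrPeriod_anyLevel : Prop :=
  ∀ {p : ℕ} [Fact p.Prime] (ι : PadicAlgCl p ≃+* ℂ) (K : Type) [Field K] [NumberField K]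
    (𝔭 : HeightOneSpectrum (𝓞 K)) (κ : ZpExtension K p) (γ : absoluteGaloisGroup K)
    {N : ℕ} [NeZero N] (W : WeierstrassCurve ℚ) [W.IsElliptic] (f : CuspForm (Gamma0 N) 2)
    (lam : HeckeCharacter K) (rlam : FramedGaloisRep K (PadicAlgCl p) 1),
    p ≠ 2 → IsNewformOf W f →
    IsImaginaryQuadratic K → ((Ideal.span {(p : ℤ)}).primesOver (𝓞 K)).ncard = 2 →
    ((p : ℕ) : 𝓞 K) ∈ 𝔭.asIdeal →
    (∀ (w : InfinitePlace K) (k : 𝓞 K), k ∈ 𝔭.asIdeal ↔ ‖ι.symm (w.embedding (k : K))‖ < 1) →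
    SatisfiesHeegnerHypothesis N K →
    (∀ ρ : ModPGaloisRep K (ZMod p) 2, (W.baseChange K).IsTorsionGaloisRep p ρ →
      FramedRep.IsAbsolutelyIrreducible ρ) →
    lam.IsUnitary → lam.HasInfinityType (fun _ ↦ (1 : ℤ)) (fun _ ↦ (-1 : ℤ)) →
    (∀ x : ideleGroup ℚ, lam (AdeleRing.ideleBaseChange ℚ K x) = 1) →
    (∀ v : HeightOneSpectrum (𝓞 K), ((p : ℕ) : 𝓞 K) ∉ v.asIdeal → lam.IsUnramifiedAt v) →
    IsPAdicAvatarOf ι lam rlam → FactorsThroughZp κ rlam →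
    κ.IsAnticyclotomic → κ.IsTopGenerator γ →
    ∃ (A : ℝ) (ΩK C : ℂ) (Ωp : (unrIntegers p)ˣ) (Q : PowerSeries (PadicComplexInt p)),
      0 < A ∧ ΩK ≠ 0 ∧ ‖((ι.symm C : PadicAlgCl p) : ℂ_[p])‖ = 1 ∧
        IsHsiehLFunction ι 𝔭 κ γ f A ΩK C ((Ωp : unrIntegers p) : ℂ_[p]) Q ∧
        ∃ n : ℕ, ‖((PowerSeries.coeff n Q : PadicComplexInt p) : ℂ_[p])‖ = 1

/-! #### Corollaries (kernel bookkeeping between named facts; nothing asserted) -/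

/-- **The any-level Thm. B fact implies the companion's Thm. B fact** (`thmB_exists_isHsiehLFunction_coeff_norm_eq_one`
= the same statement with the extra, here unused, binder `¬ p ^ 2 ∣ N` and the period read in norm one: a unit
of `R₀ ⊆ 𝒪_{ℂ_p}` has norm one, `unrIntegers.isUnit_iff_norm_eq_one`).
[cite: Hsieh2014, Thm. B p. 712 (Doc. Math. 19) = Thm. 2 (arXiv:1112.1580 p. 4)] -/
theorem thmB_exists_isHsiehLFunction_coeff_norm_eq_one_of_anyLevel
    (h : thmB_exists_isHsiehLFunction_coeff_norm_eq_one_unrPeriod_anyLevel) :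
    thmB_exists_isHsiehLFunction_coeff_norm_eq_one := by
  intro p _ ι K _ _ 𝔭 κ γ N _ W _ f lam rlam hp hf _hN hK hsplit h𝔭 hι hHeeg habs hu hinf htriv hunr hav
    hfac hκ hγ
  obtain ⟨A, ΩK, C, Ωp, Q, hA, hΩK, hC, hQ, hn⟩ :=
    h ι K 𝔭 κ γ W f lam rlam hp hf hK hsplit h𝔭 hι hHeeg habs hu hinf htriv hunr hav hfac hκ hγ
  exact ⟨A, ΩK, C, ((Ωp : unrIntegers p) : ℂ_[p]), Q, hA, hΩK, hC,
    (unrIntegers.isUnit_iff_norm_eq_one _).mp Ωp.isUnit, hQ, hn⟩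

/-- Dropping the non-vanishing clause: for `π = π_{f_E}` with `ρ̄_{E,p}|_{G_K}` absolutely irreducible, the any-level
Thm. B frame is a Thm. A frame with `R₀`-unit period at EVERY level (the shape of
`thmA_exists_isHsiehLFunction_unrPeriod_anyLevel`'s conclusion, `IsNewformOf W f` in place of `IsNewform0 f`).
[cite: Hsieh2014, Thm. A and Thm. B (Doc. Math. 19 p. 712)] -/
theorem exists_isHsiehLFunction_unrPeriod_of_thmB_anyLevel
    (h : thmB_exists_isHsiehLFunction_coeff_norm_eq_one_unrPeriod_anyLevel)
    {p : ℕ} [Fact p.Prime] (ι : PadicAlgCl p ≃+* ℂ) (K : Type) [Field K] [NumberField K]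
    (𝔭 : HeightOneSpectrum (𝓞 K)) (κ : ZpExtension K p) (γ : absoluteGaloisGroup K)
    {N : ℕ} [NeZero N] (W : WeierstrassCurve ℚ) [W.IsElliptic] (f : CuspForm (Gamma0 N) 2)
    (lam : HeckeCharacter K) (rlam : FramedGaloisRep K (PadicAlgCl p) 1)
    (hp : p ≠ 2) (hf : IsNewformOf W f) (hK : IsImaginaryQuadratic K)
    (hsplit : ((Ideal.span {(p : ℤ)}).primesOver (𝓞 K)).ncard = 2)
    (h𝔭 : ((p : ℕ) : 𝓞 K) ∈ 𝔭.asIdeal)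
    (hι : ∀ (w : InfinitePlace K) (k : 𝓞 K), k ∈ 𝔭.asIdeal ↔ ‖ι.symm (w.embedding (k : K))‖ < 1)
    (hHeeg : SatisfiesHeegnerHypothesis N K)
    (habs : ∀ ρ : ModPGaloisRep K (ZMod p) 2, (W.baseChange K).IsTorsionGaloisRep p ρ →
      FramedRep.IsAbsolutelyIrreducible ρ)
    (hu : lam.IsUnitary) (hinf : lam.HasInfinityType (fun _ ↦ (1 : ℤ)) (fun _ ↦ (-1 : ℤ)))
    (htriv : ∀ x : ideleGroup ℚ, lam (AdeleRing.ideleBaseChange ℚ K x) = 1)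
    (hunr : ∀ v : HeightOneSpectrum (𝓞 K), ((p : ℕ) : 𝓞 K) ∉ v.asIdeal → lam.IsUnramifiedAt v)
    (hav : IsPAdicAvatarOf ι lam rlam) (hfac : FactorsThroughZp κ rlam)
    (hκ : κ.IsAnticyclotomic) (hγ : κ.IsTopGenerator γ) :
    ∃ (A : ℝ) (ΩK C : ℂ) (Ωp : (unrIntegers p)ˣ) (Q : PowerSeries (PadicComplexInt p)),
      0 < A ∧ ΩK ≠ 0 ∧ ‖((ι.symm C : PadicAlgCl p) : ℂ_[p])‖ = 1 ∧
        IsHsiehLFunction ι 𝔭 κ γ f A ΩK C ((Ωp : unrIntegers p) : ℂ_[p]) Q := by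
  obtain ⟨A, ΩK, C, Ωp, Q, hA, hΩK, hC, hQ, -⟩ :=
    h ι K 𝔭 κ γ W f lam rlam hp hf hK hsplit h𝔭 hι hHeeg habs hu hinf htriv hunr hav hfac hκ hγ
  exact ⟨A, ΩK, C, Ωp, Q, hA, hΩK, hC, hQ⟩

/-- The non-vanishing clause at every level read as "`Q ≠ 0`" (companion's `ne_zero_of_coeff_norm_eq_one`).
[cite: Hsieh2014, Thm. B and p. 712 (arXiv:1112.1580 p. 4 l. 24)] -/
theorem exists_isHsiehLFunction_ne_zero_of_thmB_anyLevel
    (h : thmB_exists_isHsiehLFunction_coeff_norm_eq_one_unrPeriod_anyLevel)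
    {p : ℕ} [Fact p.Prime] (ι : PadicAlgCl p ≃+* ℂ) (K : Type) [Field K] [NumberField K]
    (𝔭 : HeightOneSpectrum (𝓞 K)) (κ : ZpExtension K p) (γ : absoluteGaloisGroup K)
    {N : ℕ} [NeZero N] (W : WeierstrassCurve ℚ) [W.IsElliptic] (f : CuspForm (Gamma0 N) 2)
    (lam : HeckeCharacter K) (rlam : FramedGaloisRep K (PadicAlgCl p) 1)
    (hp : p ≠ 2) (hf : IsNewformOf W f) (hK : IsImaginaryQuadratic K)
    (hsplit : ((Ideal.span {(p : ℤ)}).primesOver (𝓞 K)).ncard = 2)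
    (h𝔭 : ((p : ℕ) : 𝓞 K) ∈ 𝔭.asIdeal)
    (hι : ∀ (w : InfinitePlace K) (k : 𝓞 K), k ∈ 𝔭.asIdeal ↔ ‖ι.symm (w.embedding (k : K))‖ < 1)
    (hHeeg : SatisfiesHeegnerHypothesis N K)
    (habs : ∀ ρ : ModPGaloisRep K (ZMod p) 2, (W.baseChange K).IsTorsionGaloisRep p ρ →
      FramedRep.IsAbsolutelyIrreducible ρ)
    (hu : lam.IsUnitary) (hinf : lam.HasInfinityType (fun _ ↦ (1 : ℤ)) (fun _ ↦ (-1 : ℤ)))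
    (htriv : ∀ x : ideleGroup ℚ, lam (AdeleRing.ideleBaseChange ℚ K x) = 1)
    (hunr : ∀ v : HeightOneSpectrum (𝓞 K), ((p : ℕ) : 𝓞 K) ∉ v.asIdeal → lam.IsUnramifiedAt v)
    (hav : IsPAdicAvatarOf ι lam rlam) (hfac : FactorsThroughZp κ rlam)
    (hκ : κ.IsAnticyclotomic) (hγ : κ.IsTopGenerator γ) :
    ∃ (A : ℝ) (ΩK C : ℂ) (Ωp : (unrIntegers p)ˣ) (Q : PowerSeries (PadicComplexInt p)),
      0 < A ∧ ΩK ≠ 0 ∧ ‖((ι.symm C : PadicAlgCl p) : ℂ_[p])‖ = 1 ∧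
        IsHsiehLFunction ι 𝔭 κ γ f A ΩK C ((Ωp : unrIntegers p) : ℂ_[p]) Q ∧ Q ≠ 0 := by
  obtain ⟨A, ΩK, C, Ωp, Q, hA, hΩK, hC, hQ, hn⟩ :=
    h ι K 𝔭 κ γ W f lam rlam hp hf hK hsplit h𝔭 hι hHeeg habs hu hinf htriv hunr hav hfac hκ hγ
  exact ⟨A, ΩK, C, Ωp, Q, hA, hΩK, hC, hQ, ne_zero_of_coeff_norm_eq_one hn⟩

end Literature.NumberTheory.EllipticCurves.Hsieh2014

end
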